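import Literature.Barriers.CriticalPhenomena.SupercriticalSAWSpaceFillingTiltWindow
import Literature.Probability.RandomPlanarGeometry.SAWBridgeRadius
import HarnessLib

/-!
# Barrier mechanism, thirty-second audit: the sub-problem has an equivalent `μ`-FREE form —
# the explicit Hammersley–Welsh fugacities `cₙ^{-1/n} ≤ x_c ≤ bₙ^{-1/n}` at index `n ≥ δ⁻⁴`
# are volume schedules

Barrier catalogue `Literature/Barriers/CriticalPhenomena/` (D-0021); companion of
`SupercriticalSAWSpaceFillingProofs` (thirty-second audit, 2026-08-17, refuter, "barrier-audit"
gen 32, of the mechanism file `…Proofs` of `SupercriticalSAWSpaceFilling` = Theorem 1 of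
H. Duminil-Copin, G. Kozma, A. Yadin, *Supercritical self-avoiding walks are space-filling*,
Ann. IHP Probab. Stat. 50 (2014) 315–326, arXiv:1110.3074).

The catalogued technique class reads "any argument insensitive to replacing
`x_c = 1/μ(ℤ²)` — 'no closed formula exists in general' — by nearby values independently of the
mesh", and the twenty-eighth audit recorded (main file, `status:` gen 28 (a)) that numerical
knowledge of `μ` neither hurts nor helps: every certified enclosure is a FIXED interval
containing supercritical fugacities, "and mesh-adaptive enclosures of width `< δ^θ`, `θ < 1/4`,
would be schedules of class (i), which no terminating computation supplies for all `δ`".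
This file makes the positive half of that remark exact and corrects its last clause:

* `SupercriticalSAW.countFugacity n = cₙ^{-1/n}` and `SupercriticalSAW.bridgeFugacity n = bₙ^{-1/n}`
  (`cₙ` = `Literature.Probability.RandomPlanarGeometry.SAW.count n`, the number of `n`-step
  self-avoiding walks of `ℤ²`; `bₙ` = `…SAW.bridgeCount n`, the number of `n`-step bridges) are
  EXPLICIT numbers — a terminating computation at each `n`, no `μ` anywhere — with
  `cₙ^{-1/n} ≤ x_c ≤ bₙ^{-1/n}` for every `n ≥ 1` (`countFugacity_le_criticalFugacity`,
  `criticalFugacity_le_bridgeFugacity`: `μ = inf cₙ^{1/n}` and `bₙ ≤ μⁿ`) and BOTH within a factor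
  `e^{O(1/√n)}` of `x_c` (`exists_mul_exp_neg_le_countFugacity`,
  `exists_bridgeFugacity_le_mul_exp`: the two halves of Hammersley–Welsh 1962,
  `cₙ ≤ μⁿ e^{κ√n}` and `bₙ ≥ μⁿ e^{-c√n}`, both PROVED in the tree —
  `SAW.Zd.BDGS2012_HammersleyWelsh_holds`, `SAW.DKY2014_eq21_holds`);
* hence every fugacity schedule `X` with `X(δ) ∈ [c_{N(δ)}^{-1/N(δ)}, b_{N(δ)}^{-1/N(δ)}]` for an
  index `N(δ) ≥ δ⁻⁴` (eventually as `δ → 0⁺`) satisfies `|X(δ) - x_c| = O(δ²)`, i.e. is a VOLUME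
  schedule of `…VolumeWindow` (`isVolumeSchedule_of_mem_Icc`), and the SLE_{8/3} statement along
  it is EQUIVALENT to the sub-problem (`sawScalingLimitAlong_iff_of_mem_Icc`, from
  `SupercriticalSAW.sawScalingLimitAlong_iff_of_isVolumeSchedule`); in particular
  `SAWScalingLimit ↔ SAWScalingLimitAlong (δ ↦ c_{⌈δ⁻⁴⌉}^{-1/⌈δ⁻⁴⌉})` and the same with bridges
  (`sawScalingLimit_iff_along_countFugacity`, `sawScalingLimit_iff_along_bridgeFugacity`);
* conditionally, on the LEFT the index may grow at any rate: if the critical length is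
  `o_P(√(n(δ)))` in every Dobrushin domain, the count schedule `c_{n(δ)}^{-1/n(δ)}` is equivalent
  to the sub-problem for every `n(δ) → ∞` (`sawScalingLimitAlong_countFugacity_iff_of_length`,
  through the left-window criterion of `…TiltWindow`) — `n(δ) δ^{8/3} → ∞` on the predicted
  critical scale `|γ_δ| ≍ δ^{-4/3}`, the input being open beyond `|γ_δ| ≤ |Ω_δ|`.

So the sub-problem `Literature.Probability.RandomPlanarGeometry.SAW.SAWScalingLimit` can be
STATED without the connective constant: "for every Dobrushin domain and endpoint approximation,
the self-avoiding walk of `Ω_δ` weighted by `(c_{⌈δ⁻⁴⌉})^{-|γ|/⌈δ⁻⁴⌉}` converges in law to chordal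
SLE_{8/3}". Mesh-adaptive enclosures ARE supplied by terminating computations (one per mesh),
and the width that matters is not `δ^θ`, `θ < 1/4` (the blocked side of the window class) but
`O(δ²)` (its proved free side): with the Hammersley–Welsh rate the index must exceed the SQUARE
of the number of sites of the domain, `N(δ) ≳ δ⁻⁴ ≍ |Ω_δ|²`, because the enclosure has certified
width `≍ 1/√n` while the free window is `O(δ²)` — domain-intrinsic counting data
(`n ≲ |Ω_δ| ≍ δ⁻²`, certified width `≳ δ`) lands in the window range `δ² ≪ w ≪ δ^{1/4}` that no
theorem decides and that is dead in substance beyond the crossover `δ^{4/3}` [LSW04,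
Prediction 2] (on the conjectured `cₙ ∼ Aμⁿn^{γ-1}` the true width is `≍ (log n)/n`, and an index
`≍ |Ω_δ| log |Ω_δ|` would do). Nothing here is an evasion of the barrier —
the schedules are inside the class (i) windows already proved free — and nothing is claimed to
become easier: `c_{δ⁻⁴}` is no more accessible than `μ`. What is recorded is the exact sense in
which "no closed formula for `μ(ℤ²)`" is void as an obstruction: constructively, by explicit
integers, on both sides of `x_c`.

Mathlib: `Real.rpow_le_rpow`, `Real.mul_rpow`, `Real.pow_rpow_inv_natCast`, `Real.exp_mul`,
`Real.sqrt_div_self'`, `Real.add_one_le_exp`, `Real.abs_exp_sub_one_le`, `inv_anti₀`,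
`Nat.le_ceil`, `Ioo_mem_nhdsGT`.

## References

* H. Duminil-Copin, G. Kozma, A. Yadin, Ann. IHP Probab. Stat. 50 (2014) 315–326,
  arXiv:1110.3074: §1 (p. 2: "The connective constant can be approximated in a number of ways,
  yet no closed formula exists in general"), §2 eq. (2.1) (p. 4: `e^{-c√n}μⁿ ≤ bₙ ≤ μⁿ`),
  Theorem 1 (p. 2). [DuminilCopinKozmaYadin2014]
* R. Bauerschmidt, H. Duminil-Copin, J. Goodman, G. Slade, *Lectures on self-avoiding walks*,
  Clay Math. Proc. 15 (2012), §1.3 (`μ = inf cₙ^{1/n}`) and §1.5.1 eq. (1.25)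
  (`μⁿ ≤ cₙ ≤ μⁿ e^{κ√n}`). [BDGS2012]
* N. Madras, G. Slade, *The Self-Avoiding Walk* (1993), Corollary 3.1.6. [MadrasSlade1993]
* G. Lawler, O. Schramm, W. Werner, *On the scaling limit of planar self-avoiding walk* (2004),
  Prediction 2 (`ν = 3/4`). [LawlerSchrammWerner2004SAW]
-/

noncomputable section

open MeasureTheory Filter Topology Literature.Probability.LatticeModels
  Literature.Probability.Percolation Literature.Probability.RandomPlanarGeometry
  Literature.Probability.RandomPlanarGeometry.SAW
open scoped NNReal

namespace Literature.Barriers.CriticalPhenomena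

namespace SupercriticalSAW

/-! ### The explicit Hammersley–Welsh enclosure `cₙ^{-1/n} ≤ x_c ≤ bₙ^{-1/n}` -/

section Enclosure

/-- The **count fugacity** `ℓₙ = cₙ^{-1/n}`: the reciprocal of the `n`-th root of the number of
`n`-step self-avoiding walks of `ℤ²` — an explicit number, with no reference to `μ`.
[cite: BDGS2012, §1.3] -/
def countFugacity (n : ℕ) : ℝ :=
  ((count n : ℝ) ^ (1 / (n : ℝ)))⁻¹

/-- The **bridge fugacity** `uₙ = bₙ^{-1/n}`, `bₙ` the number of `n`-step bridges of `ℤ²`.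
[cite: DuminilCopinKozmaYadin2014, §2, eq. (2.1)] -/
def bridgeFugacity (n : ℕ) : ℝ :=
  ((bridgeCount n : ℝ) ^ (1 / (n : ℝ)))⁻¹

/-- `cₙ ≥ 1 > 0`. [folklore] -/
theorem cast_sawCount_pos (n : ℕ) : (0 : ℝ) < count n := by
  have h : 1 ≤ Zd.count 2 n := Zd.one_le_count 2 n
  rw [Zd.count_two] at h
  exact_mod_cast h

/-- `bₙ > 0` (from the proved lower half `e^{-c√n} μⁿ ≤ bₙ` of eq. (2.1) and `μ > 0`).
[cite: DuminilCopinKozmaYadin2014, §2, eq. (2.1)] -/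
theorem cast_bridgeCount_pos (n : ℕ) : (0 : ℝ) < bridgeCount n := by
  obtain ⟨c, hc⟩ := DKY2014_eq21_holds
  have hμ : 0 < connectiveConstant := planar_connectiveConstant_pos
  exact lt_of_lt_of_le (by positivity) (hc n).1

/-- `√n · n⁻¹ = (√n)⁻¹`. [folklore] -/
theorem sqrt_mul_inv_natCast (n : ℕ) : Real.sqrt n * ((n : ℝ))⁻¹ = (Real.sqrt n)⁻¹ := by
  rw [← div_eq_mul_inv, Real.sqrt_div_self', one_div]

/-- **`cₙ^{-1/n} ≤ x_c`** for `n ≥ 1`: `μ = infₙ cₙ^{1/n} ≤ cₙ^{1/n}`. [cite: BDGS2012, §1.3] -/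
theorem countFugacity_le_criticalFugacity {n : ℕ} (hn : n ≠ 0) :
    countFugacity n ≤ criticalFugacity := by
  have h : connectiveConstant ≤ (count n : ℝ) ^ (1 / (n : ℝ)) := by
    have := Zd.connectiveConstant_le_rpow (d := 2) hn
    rwa [Zd.count_two, Zd.connectiveConstant_two] at this
  rw [countFugacity, criticalFugacity]
  exact inv_anti₀ planar_connectiveConstant_pos h

/-- **`x_c ≤ bₙ^{-1/n}`** for `n ≥ 1`: `bₙ ≤ μⁿ`. [cite: DuminilCopinKozmaYadin2014, §2, eq. (2.1)] -/
theorem criticalFugacity_le_bridgeFugacity {n : ℕ} (hn : n ≠ 0) :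
    criticalFugacity ≤ bridgeFugacity n := by
  have hμ : 0 < connectiveConstant := planar_connectiveConstant_pos
  have hb : (0 : ℝ) < bridgeCount n := cast_bridgeCount_pos n
  have h : (bridgeCount n : ℝ) ^ ((n : ℝ)⁻¹) ≤ connectiveConstant := by
    have := Real.rpow_le_rpow hb.le (bridgeCount_le_pow n) (by positivity : (0 : ℝ) ≤ (n : ℝ)⁻¹)
    rwa [Real.pow_rpow_inv_natCast hμ.le hn] at this
  rw [bridgeFugacity, criticalFugacity, one_div]
  exact inv_anti₀ (Real.rpow_pos_of_pos hb _) h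

/-- The enclosure is an interval: `cₙ^{-1/n} ≤ bₙ^{-1/n}` (`n ≥ 1`). [folklore] -/
theorem countFugacity_le_bridgeFugacity {n : ℕ} (hn : n ≠ 0) :
    countFugacity n ≤ bridgeFugacity n :=
  (countFugacity_le_criticalFugacity hn).trans (criticalFugacity_le_bridgeFugacity hn)

/-- **Rate from below** (upper half of Hammersley–Welsh, `cₙ ≤ μⁿ e^{κ√n}`, PROVED in the tree as
`SAW.Zd.BDGS2012_HammersleyWelsh_holds`): `x_c e^{-κ/√n} ≤ cₙ^{-1/n}` for some `κ ≥ 0` and all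
`n ≥ 1`. [cite: BDGS2012, §1.5.1, eq. (1.25)] -/
theorem exists_mul_exp_neg_le_countFugacity :
    ∃ κ : ℝ, 0 ≤ κ ∧ ∀ n : ℕ, n ≠ 0 →
      criticalFugacity * Real.exp (-(κ / Real.sqrt n)) ≤ countFugacity n := by
  obtain ⟨κ, hκ⟩ := Zd.BDGS2012_HammersleyWelsh_holds 2 le_rfl
  refine ⟨max κ 0, le_max_right _ _, fun n hn => ?_⟩
  have hμ : 0 < connectiveConstant := planar_connectiveConstant_pos
  have hn' : (0 : ℝ) < n := by exact_mod_cast Nat.pos_of_ne_zero hn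
  have hs0 : 0 < Real.sqrt n := Real.sqrt_pos.2 hn'
  -- `cₙ ≤ μⁿ e^{κ' √n}`, `κ' = max κ 0`
  have h1 : (count n : ℝ) ≤ connectiveConstant ^ n * Real.exp (max κ 0 * Real.sqrt n) := by
    have h := hκ n
    rw [Zd.count_two, Zd.connectiveConstant_two] at h
    refine h.trans (mul_le_mul_of_nonneg_left (Real.exp_le_exp.2 ?_) (pow_nonneg hμ.le n))
    exact mul_le_mul_of_nonneg_right (le_max_left _ _) hs0.le
  -- `1/n`-th powers: `cₙ^{1/n} ≤ μ e^{κ'/√n}`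
  have h2 : (count n : ℝ) ^ (1 / (n : ℝ)) ≤
      connectiveConstant * Real.exp (max κ 0 / Real.sqrt n) := by
    have h := Real.rpow_le_rpow (cast_sawCount_pos n).le h1 (by positivity : (0 : ℝ) ≤ 1 / (n : ℝ))
    refine h.trans_eq ?_
    rw [Real.mul_rpow (pow_nonneg hμ.le n) (Real.exp_pos _).le, one_div,
      Real.pow_rpow_inv_natCast hμ.le hn, ← Real.exp_mul, mul_assoc, sqrt_mul_inv_natCast,
      div_eq_mul_inv]
  -- invert
  have h3 := inv_anti₀ (Real.rpow_pos_of_pos (cast_sawCount_pos n) _) h2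
  rw [mul_inv, ← Real.exp_neg] at h3
  simpa [countFugacity, criticalFugacity] using h3

/-- **Rate from above** (lower half of Hammersley–Welsh, `bₙ ≥ μⁿ e^{-c√n}`, PROVED in the tree
as `SAW.DKY2014_eq21_holds`): `bₙ^{-1/n} ≤ x_c e^{c/√n}` for some `c ≥ 0` and all `n ≥ 1`.
[cite: DuminilCopinKozmaYadin2014, §2, eq. (2.1)] -/
theorem exists_bridgeFugacity_le_mul_exp :
    ∃ c : ℝ, 0 ≤ c ∧ ∀ n : ℕ, n ≠ 0 →
      bridgeFugacity n ≤ criticalFugacity * Real.exp (c / Real.sqrt n) := by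
  obtain ⟨c, hc⟩ := DKY2014_eq21_holds
  refine ⟨max c 0, le_max_right _ _, fun n hn => ?_⟩
  have hμ : 0 < connectiveConstant := planar_connectiveConstant_pos
  have hn' : (0 : ℝ) < n := by exact_mod_cast Nat.pos_of_ne_zero hn
  have hs0 : 0 < Real.sqrt n := Real.sqrt_pos.2 hn'
  -- `e^{-c' √n} μⁿ ≤ bₙ`, `c' = max c 0`
  have h1 : Real.exp (-(max c 0 * Real.sqrt n)) * connectiveConstant ^ n ≤ bridgeCount n := by
    refine le_trans (mul_le_mul_of_nonneg_right (Real.exp_le_exp.2 ?_) (pow_nonneg hμ.le n))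
      (hc n).1
    exact neg_le_neg (mul_le_mul_of_nonneg_right (le_max_left _ _) hs0.le)
  -- `1/n`-th powers: `e^{-c'/√n} μ ≤ bₙ^{1/n}`
  have h2 : Real.exp (-(max c 0 / Real.sqrt n)) * connectiveConstant ≤
      (bridgeCount n : ℝ) ^ (1 / (n : ℝ)) := by
    have h0 : (0 : ℝ) ≤ Real.exp (-(max c 0 * Real.sqrt n)) * connectiveConstant ^ n := by
      positivity
    have h := Real.rpow_le_rpow h0 h1 (by positivity : (0 : ℝ) ≤ 1 / (n : ℝ))
    refine le_of_eq_of_le ?_ h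
    rw [Real.mul_rpow (Real.exp_pos _).le (pow_nonneg hμ.le n), one_div,
      Real.pow_rpow_inv_natCast hμ.le hn, ← Real.exp_mul, neg_mul, mul_assoc,
      sqrt_mul_inv_natCast, div_eq_mul_inv]
  -- invert
  have h3 := inv_anti₀ (by positivity) h2
  rw [mul_inv, ← Real.exp_neg, neg_neg, mul_comm] at h3
  simpa [bridgeFugacity, criticalFugacity] using h3

/-- **The enclosure has width `O(1/√n)`**: for some `C ≥ 0` and `s₀`, every `x` with
`cₙ^{-1/n} ≤ x ≤ bₙ^{-1/n}` satisfies `|x - x_c| ≤ C/√n` once `√n ≥ s₀`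
(`1 - e^{-t} ≤ t` and `e^{t} - 1 ≤ 2t` for `0 ≤ t ≤ 1`). [cite: BDGS2012, §1.5.1, eq. (1.25)] -/
theorem exists_abs_sub_criticalFugacity_le_of_mem_Icc :
    ∃ C : ℝ, 0 ≤ C ∧ ∃ s₀ : ℝ, 0 < s₀ ∧ ∀ n : ℕ, n ≠ 0 → s₀ ≤ Real.sqrt n →
      ∀ x ∈ Set.Icc (countFugacity n) (bridgeFugacity n),
        |x - criticalFugacity| ≤ C / Real.sqrt n := by
  obtain ⟨κ, hκ0, hκ⟩ := exists_mul_exp_neg_le_countFugacity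
  obtain ⟨c, hc0, hc⟩ := exists_bridgeFugacity_le_mul_exp
  have hxc : 0 < criticalFugacity := criticalFugacity_pos
  refine ⟨criticalFugacity * (κ + 2 * c), by positivity, max c 1, by positivity,
    fun n hn hs x hx => ?_⟩
  have hn' : (0 : ℝ) < n := by exact_mod_cast Nat.pos_of_ne_zero hn
  have hs0 : 0 < Real.sqrt n := Real.sqrt_pos.2 hn'
  set s : ℝ := Real.sqrt n with hs_def
  -- lower side: `x_c - x ≤ x_c (1 - e^{-κ/s}) ≤ x_c κ/s`
  have hlow : criticalFugacity - x ≤ criticalFugacity * (κ / s) := by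
    have h1 : criticalFugacity * Real.exp (-(κ / s)) ≤ x := (hκ n hn).trans hx.1
    have h2 : 1 - κ / s ≤ Real.exp (-(κ / s)) := by
      have := Real.add_one_le_exp (-(κ / s)); linarith
    nlinarith [mul_le_mul_of_nonneg_left h2 hxc.le]
  -- upper side: `x - x_c ≤ x_c (e^{c/s} - 1) ≤ 2 x_c c/s` (`c/s ≤ 1`)
  have hup : x - criticalFugacity ≤ criticalFugacity * (2 * (c / s)) := by
    have h1 : x ≤ criticalFugacity * Real.exp (c / s) := hx.2.trans (hc n hn)
    have hcs : 0 ≤ c / s := div_nonneg hc0 hs0.le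
    have hcs1 : c / s ≤ 1 := by
      rw [div_le_one hs0]
      exact (le_max_left c 1).trans hs
    have h2 : Real.exp (c / s) - 1 ≤ 2 * (c / s) := by
      have h := Real.abs_exp_sub_one_le (x := c / s) (by rwa [abs_of_nonneg hcs])
      rw [abs_of_nonneg hcs] at h
      exact (le_abs_self _).trans h
    nlinarith [mul_le_mul_of_nonneg_left h2 hxc.le]
  rw [abs_le]
  constructor
  · -- `-(C/s) ≤ x - x_c`
    have : criticalFugacity * (κ / s) ≤ criticalFugacity * (κ + 2 * c) / s := by
      rw [mul_div_assoc]
      exact mul_le_mul_of_nonneg_left (div_le_div_of_nonneg_right (by linarith) hs0.le) hxc.le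
    linarith
  · have : criticalFugacity * (2 * (c / s)) ≤ criticalFugacity * (κ + 2 * c) / s := by
      rw [mul_div_assoc]
      refine mul_le_mul_of_nonneg_left ?_ hxc.le
      rw [mul_div_assoc']
      exact div_le_div_of_nonneg_right (by linarith) hs0.le
    linarith

end Enclosure

/-! ### Schedules inside the enclosure at index `N(δ) ≥ δ⁻⁴` are volume schedules -/

section Schedule

/-- **Main lemma.** A fugacity schedule `X` with `X(δ) ∈ [c_{N(δ)}^{-1/N(δ)}, b_{N(δ)}^{-1/N(δ)}]`
for an index `N(δ) ≥ δ⁻⁴` (both eventually as `δ → 0⁺`) has `|X(δ) - x_c| = O(δ²)`: it is a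
volume schedule in the sense of `…VolumeWindow` (`IsVolumeSchedule`), because the enclosure has
width `O(1/√N(δ)) = O(δ²)`. [cite: BDGS2012, §1.5.1, eq. (1.25)] -/
theorem isVolumeSchedule_of_mem_Icc {X : ℝ → ℝ} {N : ℝ → ℕ}
    (hN : ∀ᶠ δ in 𝓝[>] (0 : ℝ), (δ ^ 2)⁻¹ ^ 2 ≤ (N δ : ℝ))
    (hX : ∀ᶠ δ in 𝓝[>] (0 : ℝ), X δ ∈ Set.Icc (countFugacity (N δ)) (bridgeFugacity (N δ))) :
    IsVolumeSchedule X := by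
  obtain ⟨C, hC0, s₀, hs₀, h⟩ := exists_abs_sub_criticalFugacity_le_of_mem_Icc
  refine ⟨C, ?_⟩
  -- eventually `δ ∈ (0, δ₁)` with `δ₁ = min 1 s₀⁻¹`, so that `(δ²)⁻¹ ≥ δ⁻¹ ≥ s₀`
  have hδ₁ : (0 : ℝ) < min 1 s₀⁻¹ := lt_min one_pos (inv_pos.2 hs₀)
  filter_upwards [hN, hX, Ioo_mem_nhdsGT hδ₁] with δ hNδ hXδ hδ
  obtain ⟨hδ0, hδ1⟩ := hδ
  have hδle1 : δ ≤ 1 := hδ1.le.trans (min_le_left _ _)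
  have hδ2 : 0 < δ ^ 2 := by positivity
  -- `s₀ ≤ (δ²)⁻¹`
  have hs₀δ : s₀ ≤ (δ ^ 2)⁻¹ := by
    have h1 : δ ^ 2 ≤ δ := by nlinarith
    have h2 : δ ≤ s₀⁻¹ := hδ1.le.trans (min_le_right _ _)
    calc s₀ = s₀⁻¹⁻¹ := (inv_inv s₀).symm
      _ ≤ δ⁻¹ := inv_anti₀ hδ0 h2
      _ ≤ (δ ^ 2)⁻¹ := inv_anti₀ hδ2 h1
  -- `N δ ≠ 0` and `(δ²)⁻¹ ≤ √(N δ)`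
  have hNpos : (0 : ℝ) < N δ := lt_of_lt_of_le (by positivity) hNδ
  have hN0 : N δ ≠ 0 := by exact_mod_cast hNpos.ne'
  have hsqrt : (δ ^ 2)⁻¹ ≤ Real.sqrt (N δ) := by
    rw [show (δ ^ 2)⁻¹ = Real.sqrt (((δ ^ 2)⁻¹) ^ 2) from
      (Real.sqrt_sq (inv_nonneg.2 hδ2.le)).symm]
    exact Real.sqrt_le_sqrt hNδ
  have hbound := h (N δ) hN0 (hs₀δ.trans hsqrt) (X δ) hXδ
  refine hbound.trans ?_
  -- `C/√N ≤ C δ²`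
  calc C / Real.sqrt (N δ) ≤ C / (δ ^ 2)⁻¹ :=
        div_le_div_of_nonneg_left hC0 (inv_pos.2 hδ2) hsqrt
    _ = C * δ ^ 2 := by rw [div_inv_eq_mul]

/-- **Along any schedule inside the Hammersley–Welsh enclosure at index `N(δ) ≥ δ⁻⁴` the
SLE_{8/3} statement is the sub-problem.** [cite: DuminilCopinKozmaYadin2014, §1 (x_c = 1/μ)] -/
theorem sawScalingLimitAlong_iff_of_mem_Icc {X : ℝ → ℝ} {N : ℝ → ℕ}
    (hN : ∀ᶠ δ in 𝓝[>] (0 : ℝ), (δ ^ 2)⁻¹ ^ 2 ≤ (N δ : ℝ))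
    (hX : ∀ᶠ δ in 𝓝[>] (0 : ℝ), X δ ∈ Set.Icc (countFugacity (N δ)) (bridgeFugacity (N δ))) :
    SAWScalingLimitAlong X ↔ SAWScalingLimit :=
  sawScalingLimitAlong_iff_of_isVolumeSchedule (isVolumeSchedule_of_mem_Icc hN hX)

/-- The mesh index `N(δ) = ⌈δ⁻⁴⌉` (written `⌈((δ²)⁻¹)²⌉₊`). [folklore] -/
def meshIndex (δ : ℝ) : ℕ :=
  ⌈((δ ^ 2)⁻¹) ^ 2⌉₊

/-- `δ⁻⁴ ≤ N(δ)`. [folklore] -/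
theorem le_meshIndex (δ : ℝ) : ((δ ^ 2)⁻¹) ^ 2 ≤ (meshIndex δ : ℝ) :=
  Nat.le_ceil _

/-- `N(δ) ≥ 1` for `δ ≠ 0`. [folklore] -/
theorem meshIndex_ne_zero {δ : ℝ} (hδ : δ ≠ 0) : meshIndex δ ≠ 0 := by
  have h : (0 : ℝ) < meshIndex δ := lt_of_lt_of_le (by positivity) (le_meshIndex δ)
  exact_mod_cast h.ne'

/-- **The sub-problem, `μ`-free, from below**: `SAWScalingLimit` holds iff the self-avoiding
walk weighted by the explicit fugacity `c_{⌈δ⁻⁴⌉}^{-1/⌈δ⁻⁴⌉}` — the reciprocal `⌈δ⁻⁴⌉`-th root of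
the number of `⌈δ⁻⁴⌉`-step self-avoiding walks of `ℤ²` — converges to chordal SLE_{8/3} in every
Dobrushin domain. [cite: DuminilCopinKozmaYadin2014, §1 (x_c = 1/μ)] -/
theorem sawScalingLimit_iff_along_countFugacity :
    SAWScalingLimit ↔ SAWScalingLimitAlong fun δ => countFugacity (meshIndex δ) := by
  refine (sawScalingLimitAlong_iff_of_mem_Icc (N := meshIndex)
    (Eventually.of_forall fun δ => le_meshIndex δ) ?_).symm
  filter_upwards [self_mem_nhdsWithin] with δ hδ
  have h0 := meshIndex_ne_zero (ne_of_gt (Set.mem_Ioi.1 hδ))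
  exact ⟨le_rfl, countFugacity_le_bridgeFugacity h0⟩

/-- **The sub-problem, `μ`-free, from above**: the same with the bridge fugacity
`b_{⌈δ⁻⁴⌉}^{-1/⌈δ⁻⁴⌉} ≥ x_c`. [cite: DuminilCopinKozmaYadin2014, §2, eq. (2.1)] -/
theorem sawScalingLimit_iff_along_bridgeFugacity :
    SAWScalingLimit ↔ SAWScalingLimitAlong fun δ => bridgeFugacity (meshIndex δ) := by
  refine (sawScalingLimitAlong_iff_of_mem_Icc (N := meshIndex)
    (Eventually.of_forall fun δ => le_meshIndex δ) ?_).symm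
  filter_upwards [self_mem_nhdsWithin] with δ hδ
  have h0 := meshIndex_ne_zero (ne_of_gt (Set.mem_Ioi.1 hδ))
  exact ⟨countFugacity_le_bridgeFugacity h0, le_rfl⟩

/-- Both explicit schedules are honest approximants: `c_{N(δ)}^{-1/N(δ)} ≤ x_c ≤ b_{N(δ)}^{-1/N(δ)}`
for every `δ ≠ 0` — a certified enclosure of `x_c` at every mesh, by terminating computations.
[cite: DuminilCopinKozmaYadin2014, §2, eq. (2.1)] -/
theorem criticalFugacity_mem_Icc_meshIndex {δ : ℝ} (hδ : δ ≠ 0) :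
    criticalFugacity ∈ Set.Icc (countFugacity (meshIndex δ)) (bridgeFugacity (meshIndex δ)) :=
  ⟨countFugacity_le_criticalFugacity (meshIndex_ne_zero hδ),
    criticalFugacity_le_bridgeFugacity (meshIndex_ne_zero hδ)⟩

/-- **Conditional refinement on the LEFT: any index growth `n(δ) → ∞`, given tightness of the
critical length below `√(n(δ))`.** If `|γ_δ|/√(n(δ)) → 0` in probability under the CRITICAL law
of every Dobrushin domain with an endpoint approximation, then the SLE_{8/3} statement along the
count schedule `c_{n(δ)}^{-1/n(δ)}` is the sub-problem (the left-window criterion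
`SupercriticalSAW.sawScalingLimitAlong_iff_of_left_window` of `…TiltWindow` with the window
`x_c - c_{n}^{-1/n} ≤ Cn^{-1/2}`): on the predicted critical scale `|γ_δ| ≍ δ^{-4/3}`
[LSW04, Prediction 2] any `n(δ)` with `n(δ) δ^{8/3} → ∞` would do; unconditionally only
`|γ_δ| ≤ |Ω_δ| = O(δ⁻²)` is available, which is the index `δ⁻⁴` of
`sawScalingLimit_iff_along_countFugacity` again. [cite: LawlerSchrammWerner2004SAW, Prediction 2] -/
theorem sawScalingLimitAlong_countFugacity_iff_of_length {n : ℝ → ℕ}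
    (hn : Tendsto (fun δ => (n δ : ℝ)) (𝓝[>] (0 : ℝ)) atTop)
    (hlen : ∀ (D : DobrushinDomain) (A B : ℝ → Site 2), IsEndpointApprox D A B → ∀ ε : ℝ, 0 < ε →
      Tendsto (fun δ => law D.carrier δ (A δ) (B δ)
        {γ | ε ≤ (γ.length : ℝ) / Real.sqrt (n δ)}) (𝓝[>] 0) (𝓝 0)) :
    SAWScalingLimitAlong (fun δ => countFugacity (n δ)) ↔ SAWScalingLimit := by
  obtain ⟨κ, hκ0, hκ⟩ := exists_mul_exp_neg_le_countFugacity
  have hxc : 0 < criticalFugacity := criticalFugacity_pos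
  set C : ℝ := criticalFugacity * κ + 1 with hC
  have hC0 : 0 < C := by positivity
  -- the window `w δ = x_c - ℓ_{n δ}` satisfies `w δ ≤ C/√(n δ)` once `n δ ≠ 0`
  have hw_le : ∀ δ, n δ ≠ 0 →
      criticalFugacity - countFugacity (n δ) ≤ C / Real.sqrt (n δ) := by
    intro δ h0
    have hs0 : 0 < Real.sqrt (n δ) :=
      Real.sqrt_pos.2 (by exact_mod_cast Nat.pos_of_ne_zero h0)
    have h1 := hκ (n δ) h0
    have h2 : 1 - κ / Real.sqrt (n δ) ≤ Real.exp (-(κ / Real.sqrt (n δ))) := by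
      have := Real.add_one_le_exp (-(κ / Real.sqrt (n δ))); linarith
    have h3 : criticalFugacity - countFugacity (n δ) ≤
        criticalFugacity * (κ / Real.sqrt (n δ)) := by
      nlinarith [mul_le_mul_of_nonneg_left h2 hxc.le]
    calc criticalFugacity - countFugacity (n δ)
        ≤ criticalFugacity * κ / Real.sqrt (n δ) := by rw [mul_div_assoc]; exact h3
      _ ≤ C / Real.sqrt (n δ) := div_le_div_of_nonneg_right (by linarith) hs0.le
  -- eventually `n δ ≥ (max 1 (2C/x_c))²`, so `n δ ≠ 0` and `C/√(n δ) ≤ x_c/2`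
  have hev : ∀ᶠ δ in 𝓝[>] (0 : ℝ), (max 1 (2 * C / criticalFugacity)) ^ 2 ≤ (n δ : ℝ) :=
    hn.eventually (eventually_ge_atTop _)
  have hn0 : ∀ᶠ δ in 𝓝[>] (0 : ℝ), n δ ≠ 0 := by
    filter_upwards [hev] with δ hδ
    have : (0 : ℝ) < n δ := lt_of_lt_of_le (by positivity) hδ
    exact_mod_cast this.ne'
  have hsqrt : ∀ᶠ δ in 𝓝[>] (0 : ℝ), max 1 (2 * C / criticalFugacity) ≤ Real.sqrt (n δ) := by
    filter_upwards [hev] with δ hδ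
    rw [show max 1 (2 * C / criticalFugacity) =
        Real.sqrt ((max 1 (2 * C / criticalFugacity)) ^ 2) from (Real.sqrt_sq (by positivity)).symm]
    exact Real.sqrt_le_sqrt hδ
  refine sawScalingLimitAlong_iff_of_left_window
    (w := fun δ => criticalFugacity - countFugacity (n δ)) ?_ ?_ ?_
  · -- `w δ ≤ x_c / 2`
    filter_upwards [hn0, hsqrt] with δ h0 hs
    have hs0 : 0 < Real.sqrt (n δ) := lt_of_lt_of_le (by positivity) hs
    refine (hw_le δ h0).trans ?_
    rw [div_le_iff₀ hs0]
    have h2 : 2 * C / criticalFugacity ≤ Real.sqrt (n δ) := (le_max_right _ _).trans hs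
    rw [div_le_iff₀ hxc] at h2
    nlinarith
  · -- tightness transfer: `{ε ≤ w δ |γ|} ⊆ {ε/C ≤ |γ|/√(n δ)}`
    intro D A B hAB ε hε
    have hlim := hlen D A B hAB (ε / C) (by positivity)
    refine tendsto_of_tendsto_of_tendsto_of_le_of_le' tendsto_const_nhds hlim
      (Eventually.of_forall fun _ => bot_le) ?_
    filter_upwards [hn0] with δ h0
    refine measure_mono fun γ hγ => ?_
    simp only [Set.mem_setOf_eq] at hγ ⊢
    have hlen0 : (0 : ℝ) ≤ (γ.length : ℝ) := Nat.cast_nonneg _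
    have h1 : ε ≤ C / Real.sqrt (n δ) * γ.length :=
      hγ.trans (mul_le_mul_of_nonneg_right (hw_le δ h0) hlen0)
    rw [div_le_iff₀ hC0]
    calc ε ≤ C / Real.sqrt (n δ) * γ.length := h1
      _ = (γ.length : ℝ) / Real.sqrt (n δ) * C := by ring
  · -- `x_c - w δ ≤ X δ ≤ x_c`
    filter_upwards [hn0] with δ h0
    exact ⟨by linarith, countFugacity_le_criticalFugacity h0⟩

end Schedule

end SupercriticalSAW

open SupercriticalSAW

/-- **Barrier `SupercriticalSAWSpaceFillingCountSchedule`** (thirty-second audit of `…Proofs`,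
PROVED below): the "no closed formula for `μ(ℤ²)`" clause of the technique class of
`SupercriticalSAWSpaceFilling` is void as an obstruction CONSTRUCTIVELY — the sub-problem is
equivalent to the SLE_{8/3} statement along the explicit, `μ`-free fugacity schedules
`c_{⌈δ⁻⁴⌉}^{-1/⌈δ⁻⁴⌉}` (from below) and `b_{⌈δ⁻⁴⌉}^{-1/⌈δ⁻⁴⌉}` (from above), and along every
schedule inside the Hammersley–Welsh enclosure `[cₙ^{-1/n}, bₙ^{-1/n}] ∋ x_c` at index
`n = N(δ) ≥ δ⁻⁴`.

BARRIER (structured block, D-0021):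
- technique_class: explicit-enclosure fugacity schedules (an SLE_{8/3} conclusion asserted along a schedule `X(δ) ∈ [c_{N(δ)}^{-1/N(δ)}, b_{N(δ)}^{-1/N(δ)}]`, `N(δ) ≥ δ⁻⁴` — mesh-adaptive certified enclosures of `x_c` supplied by terminating computations, one per mesh) — recorded as an entry only to correct the reading of the parent's clause "no closed formula exists in general" [cite: DuminilCopinKozmaYadin2014, §1] and of its twenty-eighth audit ("no terminating computation supplies [mesh-adaptive enclosures] for all `δ`"): this class is FREE, being inside the volume windows `O(δ²)` of `SupercriticalSAWSpaceFillingVolumeWindow`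
- blocks: nothing — on the contrary `SAWScalingLimit ↔ SupercriticalSAW.SAWScalingLimitAlong (δ ↦ c_{⌈δ⁻⁴⌉}^{-1/⌈δ⁻⁴⌉})` (`SupercriticalSAW.sawScalingLimit_iff_along_countFugacity`), `SAWScalingLimit ↔ SupercriticalSAW.SAWScalingLimitAlong (δ ↦ b_{⌈δ⁻⁴⌉}^{-1/⌈δ⁻⁴⌉})` (`SupercriticalSAW.sawScalingLimit_iff_along_bridgeFugacity`), and `SupercriticalSAW.SAWScalingLimitAlong X ↔ SAWScalingLimit` for every schedule in the enclosure at index `≥ δ⁻⁴` (`SupercriticalSAW.sawScalingLimitAlong_iff_of_mem_Icc`) — all unconditional (axioms `propext`, `Classical.choice`, `Quot.sound`) — and, conditionally on the critical length being `o_P(√(n(δ)))`, along `c_{n(δ)}^{-1/n(δ)}` for any `n(δ) → ∞` (`SupercriticalSAW.sawScalingLimitAlong_countFugacity_iff_of_length`)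
- because: `μ = infₙ cₙ^{1/n}` and `bₙ ≤ μⁿ` give `cₙ^{-1/n} ≤ x_c ≤ bₙ^{-1/n}` (`SupercriticalSAW.countFugacity_le_criticalFugacity`, `SupercriticalSAW.criticalFugacity_le_bridgeFugacity`) [cite: BDGS2012, §1.3], the two halves of Hammersley–Welsh, `cₙ ≤ μⁿe^{κ√n}` and `bₙ ≥ μⁿe^{-c√n}` [cite: BDGS2012, §1.5.1, eq. (1.25)] [cite: DuminilCopinKozmaYadin2014, §2, eq. (2.1)] — both PROVED in the tree (`SAW.Zd.BDGS2012_HammersleyWelsh_holds`, `SAW.DKY2014_eq21_holds`) — give the width `|x - x_c| ≤ C/√n` on the enclosure (`SupercriticalSAW.exists_abs_sub_criticalFugacity_le_of_mem_Icc`), so at index `n ≥ δ⁻⁴` the schedule is within `C δ²` of `x_c`, a volume schedule (`SupercriticalSAW.isVolumeSchedule_of_mem_Icc`), along which the SLE_{8/3} statement is the sub-problem (`SupercriticalSAW.sawScalingLimitAlong_iff_of_isVolumeSchedule`: bounded mutual densities and the zero density forced by an SLE_κ limit, `κ ≤ 4` [cite: RohdeSchramm2005, Thm 8.1])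
- evasions_known: not applicable (free class, no evasion of the parent: the schedules lie inside the class-(i) windows already proved free); nothing becomes easier — `c_{⌈δ⁻⁴⌉}` is no more accessible than `μ` — and with the Hammersley–Welsh rate the index must exceed the SQUARE of the number of sites of the domain, `N(δ) ≳ δ⁻⁴ ≍ |Ω_δ|²`: the enclosure at index `n` has certified width `≍ 1/√n` while the proved free window is `O(δ²)`, so domain-intrinsic counting data, `n ≲ |Ω_δ| ≍ δ⁻²`, only certifies windows `≳ δ`, inside the range `δ² ≪ w ≪ δ^{1/4}` decided by no theorem and dead in substance beyond the crossover `δ^{4/3}` [cite: LawlerSchrammWerner2004SAW, Prediction 2] (on the predicted asymptotics `cₙ ∼ Aμⁿn^{γ-1}`, `γ = 43/32` [cite: MadrasSlade1993, §1.1], the true width is `≍ (log n)/n` and an index `≍ δ⁻² log(1/δ) ≍ |Ω_δ| log|Ω_δ|` would reach the free window — a prediction, by no declaration); on the LEFT the index may grow at ANY rate `n(δ) → ∞` provided the critical length is `o_P(√(n(δ)))` (`SupercriticalSAW.sawScalingLimitAlong_countFugacity_iff_of_length`, from the left-window criterion `SupercriticalSAW.sawScalingLimitAlong_iff_of_left_window`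 of `…TiltWindow`), e.g. `n(δ) δ^{8/3} → ∞` on the predicted critical scale `|γ_δ| ≍ δ^{-4/3}` [cite: LawlerSchrammWerner2004SAW, Prediction 2] — no bound on the critical length beyond `|γ_δ| ≤ |Ω_δ|` being available
- scope_caveats: `ℤ²`, every Dobrushin domain and endpoint approximation (as the sub-problem); the equivalences are for the SLE_{8/3} identification (`κ = 8/3 ≤ 4`, through `…VolumeWindow` / `…TiltWindow`); the index threshold `N(δ) ≥ δ⁻⁴` (eventually as `δ → 0⁺`) carries the unoptimised Hammersley–Welsh constants of the tree (`κ = c₁ + 15`) inside the window constant `C`, smaller indices are covered only conditionally (left side, `…_iff_of_length`); fixed, mesh-independent enclosures of `x_c` remain refuted as in the parent (`SupercriticalSAW.not_sawScalingLimitAt_of_lt`: they contain supercritical fugacities) [cite: DuminilCopinKozmaYadin2014, Theorem 1]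
- status: established (proved in the tree: `SupercriticalSAWSpaceFillingCountSchedule_holds`)

[cite: DuminilCopinKozmaYadin2014, §1 (x_c = 1/μ) and Theorem 1] -/
def SupercriticalSAWSpaceFillingCountSchedule : Prop :=
  (SAWScalingLimit ↔
      SupercriticalSAW.SAWScalingLimitAlong fun δ =>
        SupercriticalSAW.countFugacity (SupercriticalSAW.meshIndex δ)) ∧
    (SAWScalingLimit ↔
      SupercriticalSAW.SAWScalingLimitAlong fun δ =>
        SupercriticalSAW.bridgeFugacity (SupercriticalSAW.meshIndex δ)) ∧
    ∀ (X : ℝ → ℝ) (N : ℝ → ℕ),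
      (∀ᶠ δ in 𝓝[>] (0 : ℝ), (δ ^ 2)⁻¹ ^ 2 ≤ (N δ : ℝ)) →
      (∀ᶠ δ in 𝓝[>] (0 : ℝ), X δ ∈ Set.Icc (SupercriticalSAW.countFugacity (N δ))
        (SupercriticalSAW.bridgeFugacity (N δ))) →
      (SupercriticalSAW.SAWScalingLimitAlong X ↔ SAWScalingLimit)

/-- **The count-schedule entry holds.** [cite: DuminilCopinKozmaYadin2014, §1 (x_c = 1/μ) and Theorem 1] -/
theorem SupercriticalSAWSpaceFillingCountSchedule_holds : SupercriticalSAWSpaceFillingCountSchedule :=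
  ⟨sawScalingLimit_iff_along_countFugacity, sawScalingLimit_iff_along_bridgeFugacity,
    fun _ _ hN hX => sawScalingLimitAlong_iff_of_mem_Icc hN hX⟩

end Literature.Barriers.CriticalPhenomena
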